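import Summits.ResolutionOfSingularities.ResolutionOfSingularities.Theorems.WeightedInvariantLocalWeightedDropNCDirectrixCutPhase


/-!
# `LocalWeightedDrop`: RD-ALIGNMENT of the wild residuals and the DIRECTRIX CUT of the equimultiple phase
# (strategist line `directrix-cut` for W4|₄ = `stub_wildWideApexFourStartsWon`; the phase assembly is generic in the dimension)

[ADOPTION RECORD: this tree module is one of four files (`…NCDirectrixCutAlign` ← `…NCDirectrixCutPhase` ← `…NCDirectrixCutHist` ←
`…NCDirectrixCut`) into which res-L1-w43-stub-4 (gen 5, adoption hand, 2026-08-27) split res-L1-w43-strat-1's farm-clean strategist module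
`L/res-L1-w43-strat-1/g8/directrix_cut_v3_1.lean` (sha16 25b57d7ac1dae990, gens 7–8; offer (i) 14:58:21Z), because of the lint «Theorems files with
proofs ≤ 400 lines».  Declaration texts are VERBATIM with ONE systematic edit: the notational `abbrev Decoration.IsInv` of the source is UNFOLDED in
place and not declared (res-L1-w43-lead-1's regime vocabulary `…NCResRegimeDefs` declares `Decoration.IsInv` with the same meaning).  Author of the
mathematics and the text: res-L1-w43-strat-1.  The module-level commentary below is the author's, kept whole in each part for context.]

THIS PART (3/4): §5 — the HISTORY-FIRST cut (OldExit, FreeLow, FreeTame, ApexLineCurveExit, ApexPlaneExit), the apex sub-cut, and stub E ⇐ the door one dimension lower.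

[OURS · L1 W4.3 · chain w43 · ENGINE crux `LocalWeightedDrop` stmt-ResolutionOfSingularities-8899; registered skeleton of record v32
(`L/res-L1-w43-lead-1/g4/LocalWeightedDrop_v32.lean`, sha16 ddb48572591139d5, registrar res-L1-w43-lead-1); strategist res-L1-w43-strat-1 gens 7–8 (v3: §5–§6 added in gen 8).
Game bookkeeping over the programme's own NC count game (res-type-056 / res-L1-w43-stub-1's S-SET decorations); NOT a statement of any manuscript;
AI-produced, weaker than expert review.  This file closes NO registered stub by name: it proves the residuals WITH EXTRA HYPOTHESES (named below).]

## §1  RD-alignment: the ORDINAL transport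
`won_of_winsOrd` — the transport `won_of_winsIn` (p507842) with well-founded induction on the GAME VALUE instead of the round number: a
TRANSFINITELY winnable position of the NC count game (`WinsOrd GermIsNC α b`, …NCGameRank) makes every divisor of a power of `b` a won germ of the
weighted game.  Hence the residual stubs follow BY NAME from the ORDINAL RANK-DROP statement
  (RD_m)  `∃ ρ : k⟦x₀..x_m⟧ → Ordinal, ∀ b ≠ 0, ¬ GermIsNC b → ∃ smooth-centre move, ρ drops at every answer`
— literally the text of the registered stub `stub_spaceNCRankDrop` (m = 2) one dimension up — instead of the uniform-in-the-answers finite round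
bound (TOT_m) of p507842: `wildWideApexFourStartsWon_of_ncRankDrop` (W4|₄ ⇐ RD₃), `wildWideApexFiveUpStartsWon_of_ncRankDrop` (W4|₅₊ ⇐ RD_{n+4}),
and — the tame maximal-contact DIMENSION DROP, ordinal form of res-type-088's `tameWideApexHigherStartsWon_of_tot_of_mono` (p506334) —
`tameWideApexFiveUpStartsWon_of_ncRankDropBelow` (T″|₅₊ at `N = n + 5` ⇐ RD_{n+3}, i.e. the NC game in ONE FEWER variable, through
`TameLift.tameWon_of_tupleDrop` + `tupleDrop_of_rank_of_monomialPhase` + `germMonomialPhase`).  So T″|₅ and W4|₄ cost the SAME statement RD₃.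

## §2  The PHASE ASSEMBLY — REBASED (v2) on res-L1-w43-stub-1's landed `…NCResPhaseAssembly` (p534993: product states `k⟦x⟧ × Decoration k m`,
germ `Prod.fst`, `Admissible` carried in the targets; `dWinsTo_germIsNC_of_headPhase`, `ncRankDrop_of_headPhase`, `ncRankDrop_of_highPhase_of_rung`).
This file adds only: `HighExit m` (the `o ≥ 2` phase WITH the normal-crossing exit — CJS-faithful: Σ^{O,max} is eliminated OR the germ resolves;
stub-1's exit-free `hhigh` implies it, `highExit_of_high`), the ORDINAL endgame (`EndOrd m`, `endOrd_of_endR8`, `DWinsTo.of_winsOrd` = transfinite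
wins are decorated wins, `dWinsTo_end_of_ordRung`, `endPhase_of_ordRung[']`), and `rd_of_highExit_of_end` / `rd_of_highExit_of_ordRung :
HighExit m → EndOrd m → RD_m` (so that the rank-drop statement one dimension LOWER can feed the endgame — see the card, stub E).

## §3  The DIRECTRIX CUT of a phase (every `m`; the new decomposition)
`UnaryVertex δ` := the initial form of the TOTAL-WITH-HISTORY `f̃ = f · ∏_{l ∈ O} X_l` (order `c = o + |O|`; TOT2-LINE v1.1 (B): e(f̃) = e^O) is
invariant under `m` linearly independent translations — i.e. `in_c(f̃) = λ·ℓ^c` is a power of ONE linear form, `e(f̃) = m = dim X`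
(over an algebraically closed field the translation-invariance vectors of a form are exactly its directrix: a homogeneous additive stabiliser is a
linear subspace, and invariance under a whole subspace `W` means the form lies in `Sym((V/W)^*)`).  The phase splits as
  `CoreUnary m` := from `e(f̃) = m`, `o ≥ 2`: reach «NC ∨ head drops ∨ (same head ∧ e(f̃) < m)» — split further into `CoreUnaryTame p m`
                   (`O ≠ ∅ ∨ p ∤ o`: maximal contact exists) and `CoreUnaryWild p m` (`O = ∅ ∧ p ∣ o`), classes preserved along equal heads;
  `TermLow m`   := from `e(f̃) < m`, `o ≥ 2`: reach «NC ∨ head drops»;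
  `phase_of_dirCut : CoreUnary m → TermLow m → Phase m` (`DWinsTo.bind`; a state with the same head has the same `o ≥ 2`).
WHY THIS CUT (m = 3, threefold hypersurface germs in 4-space, the wild residual W4|₄).  Cossart–Jannsen–Saito (LNM 2270 = arXiv:0905.2191) p.9:
«the proofs in §§11–13 show that [the key termination] Theorems 5.35 and 5.40 hold for X of ARBITRARY dimension, with the condition that the
geometric dimension of the directrix is ≤ 2»; Thm 2.10(4) (e does not increase at near points) is characteristic- and dimension-free; Thm 2.14
(near points lie on ℙ(Dir)) needs «char ≥ dim X/2 + 1» only through Hironaka's group scheme `B_{P,x′}`, which at a RATIONAL point `x′` is the line of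
`x′` — so at the closed points of our games over `k = k̄` it holds in every characteristic.  Hence `TermLow 3` is CJS-transcription (XL, in print modulo
the quoted remark), `EndOrd 3` is embedded resolution of the boundary-trace SURFACES in the regular threefold `V(f)` (CJS Thm 0.3, dimension two in a
regular ambient scheme of any dimension: in print; inside the programme it is the rank-drop statement `RD 2` — the registered `stub_spaceNCRankDrop` —
plus a sheet-separation lift, see the card), and `CoreUnary 3` — `in_c(f̃) = z^c`, `p ∣ o` forced by the engine's tangent-cone cuts — is THE OPEN
THREEFOLD CORE (the hypersurfaces `z^{p e} + …` of Cossart–Piltant 2008-II, known only by local uniformization).  At `m = 2` the same cut separates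
TOT2-LINE's S-E2′ (unary vertex, the polyhedron regime) from S-E1/S-E0/S-CRV.

## §4  BY NAME
`wildWideApexFourStartsWon_of_dirCut : CoreUnaryWild₃ → CoreUnaryTame₃ → TermLow₃ → EndOrd₃ → W4|₄` (statement of the registered stub VERBATIM), sorry-free;
`spaceNCRankDrop_of_dirCut : CoreUnary₂ → TermLow₂ → EndOrd₂ → (text of stub_spaceNCRankDrop)`.
## §5  The HISTORY-FIRST cut (v3, every `m`) — the cut of record for the line from gen 8 on
`OldExit m` (an old letter is present: the old component is a RIGID hypersurface of maximal contact for free — (P2) + «same head keeps `|O|`»; at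
`m = 3` its content is Kawanoue–Matsuki's IFP resolution in ambient dimension 3, arXiv:1205.4556, applied on the old component, modulo the game
dictionary) · `FreeLow m` (`O = ∅`, `f` not unary: the GENUINE CJS regime — condition (3e) `e_x ≤ 2` holds at `m = 3`) · `FreeTame p m` (`O = ∅`, unary,
`p ∤ o`: Giraud contact + the same threefold marked-ideal game) · `CoreUnaryWild p m` (unchanged: THE open core); `highExit_of_histCut`, `rd_of_histCut`.
The apex sub-cut of `FreeLow`: its `e = 0` and `e = 1`-isolated parts are TREE THEOREMS for every `m` (`dWinsTo_headDrop_of_apexTrivial` p537041,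
`TOT2E1.dWinsTo_headDrop_of_isolated` p536552), leaving `ApexLineCurveExit m` (`e = 1` on an equimultiple formal curve; L, OURS) and `ApexPlaneExit m`
(`2 ≤ e ≤ m - 1`; at `m = 3`: CJS Thms 5.35/5.40 one ambient dimension up; XXL): `freeLow_of_apexCut`, `rd_of_histApexCut`.
ERRATUM to §3's reading «`TermLow 3` is CJS-transcription»: `TermLow` (v2) contains the states «`|O| = 1`, `e_x(f) = 3`, `p ∣ o`» for which CJS
Thm 5.28 (3e) fails; they belong to `OldExit` (Kawanoue–Matsuki on the old component), which is why v3 cuts by the history FIRST.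

`endOrd_of_rd : RD k m → EndOrd k (m + 1)` — stub E of the line IS the registered door stub one dimension lower (res-D-pv-006 p539872
`NCTransport.exists_winsOrd_orderOne_mul_prod_of_rankDrop`); `rd_succ_of_histApexCut` = the inductive form (RD_{m+1}) ⟸ five pieces + (RD_m).

## §6  BY NAME (v3)
`wildWideApexFourStartsWon_of_histCut : CoreUnaryWild₃ → FreeTame₃ → OldExit₃ → ApexLineCurveExit₃ → ApexPlaneExit₃ → (door text) → W4|₄`
(W4|₄ and the door `stub_spaceNCRankDrop` both VERBATIM from v32), sorry-free; `rd_three_of_histCut` (the five pieces + `RD k 2` give `RD k 3`, which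
T″|₅ consumes through `tameWideApexFiveUpStartsWon_of_ncRankDropBelow`).
-/


set_option linter.dupNamespace false -- mandated namespace of this single-conjunct summit

noncomputable section

open Literature.AlgebraicGeometry.Resolution

namespace Summit.ResolutionOfSingularities.ResolutionOfSingularities.Theorems

namespace TameFourTupleDrop

open MvPowerSeries

variable {k : Type} [Field k] {m : ℕ}

/-! ## §5 The HISTORY-FIRST cut of the `o ≥ 2` phase (v3, every `m`; strategist res-L1-w43-strat-1 gen 8)

THE OBSERVATION.  At an admissibly decorated state with an OLD letter `l ∈ O`, the old component `H = V(x_l)` is a RIGID hypersurface of maximal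
contact FOR FREE: (P2) keeps every B-permissible centre inside `H`, and a successor with the same head `(o, c)` keeps `|O|`, hence keeps `l`
(its strict transform passes through the new point).  Writing `f = Σ_j a_j(x′) x_l^j`, «order of `f` stays `o` and `l` survives» is exactly
«the controlled transform of the coefficient marked ideal `((a_j, o - j))_{j<o} + ((x_{l′}|_H, 1))_{l′ ∈ O ∖ l}` on the regular THREEFOLD `H`
(`m = 3`) still has the new point in its cosupport» — so the whole class `|O| ≥ 1` (unary or not, `p ∣ o` or not) is ONE piece `OldExit`, whose
content in print is Kawanoue–Matsuki's resolution of idealistic filtrations in ambient dimension 3 (arXiv:1205.4556, local, `k = k̄`, every `p`)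
modulo the game dictionary.  This class contains germs with `p ∣ o`, `e_x(f) = m` and a transversal old letter, for which Cossart–Jannsen–Saito's
Thm 5.28 condition (3e) FAILS (`e_x = 3 > 2` at `m = 3`) — they are NOT in the CJS regime, contrary to the coarser v2 cut (`TermLow` ∋ them).
With `O = ∅` one has `c = o`, `f̃ = f`, and the class `O = ∅` is closed under same-head play; it is cut by the directrix of `f` itself:
`FreeLow` (`e_x(f) ≤ m - 1`, i.e. not unary; at `m = 3` the GENUINE CJS regime `e ≤ 2`, (3e) now holds), `FreeTame` (unary, `p ∤ o`: Giraud's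
contact hypersurface `D^{(o-1)} f = 0` + the same threefold marked-ideal game) and the untouched open core `CoreUnaryWild` (unary, `O = ∅`, `p ∣ o`).
`FreeLow` is cut once more by the apex dimension `e^O = e`, and its `e = 0` and `e = 1`-isolated parts are ALREADY IN THE TREE for every `m`
(`dWinsTo_headDrop_of_apexTrivial`, res-L1-w43-stub-1 p537041; `TOT2E1.dWinsTo_headDrop_of_isolated`, res-type-056 p536552 = CJS Cor. 5.37 in
the count game), leaving `ApexLineCurveExit` (`e = 1`, the point lies on an equimultiple formal curve: CJS Thm 5.35's excluded case, handled by
blowing the curve up once it is n.c. with the letters) and `ApexPlaneExit` (`2 ≤ e ≤ m - 1`; at `m = 3`: `e = 2`, CJS Thms 5.35/5.40, which «hold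
for X of arbitrary dimension, but with the condition that the geometric dimension of the directrix is ≤ 2», LNM 2270 p. 9). -/

/-- `OldExit`: from every admissibly decorated state with `o ≥ 2` and AN OLD LETTER PRESENT (`O ≠ ∅`) the mover forces «NC, or admissible with
smaller head».  (The rigid-maximal-contact class; at `m = 3`: Kawanoue–Matsuki on the old component, plus the dictionary.) -/
def OldExit (k : Type) [Field k] (m : ℕ) : Prop :=
  ∀ (b : MvPowerSeries (Fin (m + 1)) k) (δ : Decoration k m), Admissible b δ → 2 ≤ δ.o → δ.O.Nonempty →
    DWinsTo (St := MvPowerSeries (Fin (m + 1)) k × Decoration k m) Prod.fst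
      (fun τ => GermIsNC τ.1 ∨ (Admissible τ.1 τ.2 ∧ τ.2.head < δ.head)) (b, δ)

/-- `FreeLow`: from every admissibly decorated state with `o ≥ 2`, NO old letter (`O = ∅`, so `c = o`, `f̃ = f`) and `f` NOT unary
(`e_x(f) ≤ m - 1`; at `m = 3` the CJS regime `e ≤ 2` with (3e) holding) the mover forces «NC, or admissible with smaller head». -/
def FreeLow (k : Type) [Field k] (m : ℕ) : Prop :=
  ∀ (b : MvPowerSeries (Fin (m + 1)) k) (δ : Decoration k m), Admissible b δ → 2 ≤ δ.o → δ.O = ∅ → ¬ UnaryVertex δ →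
    DWinsTo (St := MvPowerSeries (Fin (m + 1)) k × Decoration k m) Prod.fst
      (fun τ => GermIsNC τ.1 ∨ (Admissible τ.1 τ.2 ∧ τ.2.head < δ.head)) (b, δ)

/-- `FreeTame p`: from every admissibly decorated UNARY state with `o ≥ 2`, `O = ∅` and `p ∤ o` (TAME: the Tschirnhaus / Giraud hypersurface of
maximal contact `D^{(o-1)} f = 0` exists and persists at same-order successors) the mover forces «NC, or admissible with smaller head, or admissible
with the same head and no longer unary» (the third exit hands over to `FreeLow`: same head and `O = ∅` give `O′ = ∅`). -/
def FreeTame (p : ℕ) (k : Type) [Field k] (m : ℕ) : Prop :=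
  ∀ (b : MvPowerSeries (Fin (m + 1)) k) (δ : Decoration k m), Admissible b δ → 2 ≤ δ.o → δ.O = ∅ → UnaryVertex δ → ¬ p ∣ δ.o →
    DWinsTo (St := MvPowerSeries (Fin (m + 1)) k × Decoration k m) Prod.fst
      (fun τ => GermIsNC τ.1 ∨ (Admissible τ.1 τ.2 ∧ (τ.2.head < δ.head ∨ (τ.2.head = δ.head ∧ ¬ UnaryVertex τ.2)))) (b, δ)

/-- Same head and `O = ∅` force `O′ = ∅` (`c = o + |O|`). -/
theorem Decoration.O_eq_empty_of_head_eq {δ δ' : Decoration k m} (h : δ'.head = δ.head) (hO : δ.O = ∅) : δ'.O = ∅ := by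
  have h' := h
  rw [Decoration.head, Decoration.head, toLex_inj] at h'
  have ho : δ'.o = δ.o := (Prod.ext_iff.mp h').1
  have hc : δ'.c = δ.c := (Prod.ext_iff.mp h').2
  rw [Decoration.c, Decoration.c, ho, hO, Finset.card_empty, add_zero] at hc
  exact Finset.card_eq_zero.mp (by omega)

/-- Same head forces the same `o`. -/
theorem Decoration.o_eq_of_head_eq {δ δ' : Decoration k m} (h : δ'.head = δ.head) : δ'.o = δ.o := by
  have h' := h
  rw [Decoration.head, Decoration.head, toLex_inj] at h'
  exact (Prod.ext_iff.mp h').1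

/-- **THE HISTORY-FIRST CUT COMPOSES** (`DWinsTo.bind`): `OldExit`, `FreeLow`, `FreeTame p`, `CoreUnaryWild p` ⊢ `HighExit` — case split on
`O = ∅`, unary, `p ∣ o`; the unary sub-cores' third exit (same head, not unary, hence `O′ = ∅` and `o′ = o ≥ 2`) is continued by `FreeLow`. -/
theorem highExit_of_histCut {p : ℕ} (hold : OldExit k m) (hlow : FreeLow k m) (htame : FreeTame p k m)
    (hwild : CoreUnaryWild p k m) : HighExit k m := by
  intro b δ hadm ho
  by_cases hO : δ.O = ∅
  · by_cases hU : UnaryVertex δ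
    · have hcore : DWinsTo (St := MvPowerSeries (Fin (m + 1)) k × Decoration k m) Prod.fst
          (fun τ => GermIsNC τ.1 ∨ (Admissible τ.1 τ.2 ∧ (τ.2.head < δ.head ∨ (τ.2.head = δ.head ∧ ¬ UnaryVertex τ.2)))) (b, δ) := by
        by_cases hp : p ∣ δ.o
        · exact hwild b δ hadm ho hU hO hp
        · exact htame b δ hadm ho hO hU hp
      refine hcore.bind fun τ hτ => ?_
      rcases hτ with hnc | ⟨hadmτ, hlt | ⟨heq, hnU⟩⟩
      · exact DWinsTo.of_target (Or.inl hnc)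
      · exact DWinsTo.of_target (Or.inr ⟨hadmτ, hlt⟩)
      · have hoτ : 2 ≤ τ.2.o := by rw [Decoration.o_eq_of_head_eq heq]; exact ho
        have hwin := hlow τ.1 τ.2 hadmτ hoτ (Decoration.O_eq_empty_of_head_eq heq hO) hnU
        rw [heq] at hwin
        exact hwin
    · exact hlow b δ hadm ho hO hU
  · exact hold b δ hadm ho (Finset.nonempty_iff_ne_empty.mpr hO)

/-- (RD_m) from the history-first cut and the ordinal endgame rung. -/
theorem rd_of_histCut {p : ℕ} (hold : OldExit k m) (hlow : FreeLow k m) (htame : FreeTame p k m) (hwild : CoreUnaryWild p k m)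
    (hend : EndOrd k m) : RD k m :=
  rd_of_highExit_of_ordRung (highExit_of_histCut hold hlow htame hwild) hend

/-- The v2 pieces give the v3 pieces restricted to `O = ∅` (so v3 asks for LESS outside `OldExit`): `CoreUnaryTame p` ⊢ `FreeTame p`. -/
theorem freeTame_of_coreUnaryTame {p : ℕ} (h : CoreUnaryTame p k m) : FreeTame p k m :=
  fun b δ hadm ho _ hU hp => h b δ hadm ho hU fun hh => hp hh.2

/-- … and `TermLow` ⊢ `FreeLow`. -/
theorem freeLow_of_termLow (h : TermLow k m) : FreeLow k m :=
  fun b δ hadm ho _ hnU => h b δ hadm ho hnU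

/-! ### The apex sub-cut of `FreeLow` (every `m`): `e = 0` and `e = 1`-isolated are in the tree -/

/-- `ApexLineCurveExit`: `O = ∅`, `o ≥ 2`, apex of `in_o f` a LINE (`e = 1`) and the point NOT isolated — some legal coordinate change `Φ` puts `f` in
the `c`-th power of the ideal of the last coordinate axis (`InAxisIdeal`: `f` is equimultiple along a regular formal curve, necessarily tangent to
the apex line) ⇒ the mover forces «NC, or admissible with smaller head».  STRATEGY (CJS §5, proof of Thm 5.28 Steps 1–2, with (4e) earned by point
blow-ups): blow up the point while some letter is tangent-but-not-containing or two letters are transversal to the curve (the curve persists through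
the unique near point = its direction, `InAxisIdeal` persists in the direction chart, the new exceptional letter is transversal to it, contact
orders of tangent letters drop by one); then the curve is n.c. with the letters, the move «curve in straightening coordinates» is B-permissible and
has no near answer (`e ≤ 1` and a centre of positive dimension: `TOT2Near.order_slice_lt_of_apexLine_curve` on `Φ^* f`, cf.
`dWinsTo_headDrop_of_apexLine_axis`).  L-sized, OURS, every `m`. -/
def ApexLineCurveExit (k : Type) [Field k] (m : ℕ) : Prop :=
  ∀ (b : MvPowerSeries (Fin (m + 1)) k) (δ : Decoration k m), Admissible b δ → 2 ≤ δ.o → δ.O = ∅ →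
    (∃ v : Fin (m + 1) → k, v ≠ 0 ∧ (∀ x : Fin (m + 1) → k, CobordantChart.initEval (fun _ : Fin (m + 1) => 1) (x + v) δ.c (δ.f * ∏ l ∈ δ.O, X l) =
      CobordantChart.initEval (fun _ : Fin (m + 1) => 1) x δ.c (δ.f * ∏ l ∈ δ.O, X l))) →
    (∀ v₁ v₂ : Fin (m + 1) → k, (∀ x : Fin (m + 1) → k, CobordantChart.initEval (fun _ : Fin (m + 1) => 1) (x + v₁) δ.c (δ.f * ∏ l ∈ δ.O, X l) =
      CobordantChart.initEval (fun _ : Fin (m + 1) => 1) x δ.c (δ.f * ∏ l ∈ δ.O, X l)) → (∀ x : Fin (m + 1) → k, CobordantChart.initEval (fun _ : Fin (m + 1) => 1) (x + v₂) δ.c (δ.f * ∏ l ∈ δ.O, X l) =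
      CobordantChart.initEval (fun _ : Fin (m + 1) => 1) x δ.c (δ.f * ∏ l ∈ δ.O, X l)) → ∃ α β : k, (α ≠ 0 ∨ β ≠ 0) ∧ α • v₁ + β • v₂ = 0) →
    (∃ Φ : Fin (m + 1) → MvPowerSeries (Fin (m + 1)) k, (∀ l, constantCoeff (Φ l) = 0) ∧
      IsUnit (Matrix.det (Matrix.of fun a j : Fin (m + 1) => coeff (Finsupp.single j 1) (Φ a))) ∧
      AxisPolyhedron.InAxisIdeal δ.c (subst Φ (δ.f * ∏ l ∈ δ.O, X l))) →
    DWinsTo (St := MvPowerSeries (Fin (m + 1)) k × Decoration k m) Prod.fst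
      (fun τ => GermIsNC τ.1 ∨ (Admissible τ.1 τ.2 ∧ τ.2.head < δ.head)) (b, δ)

/-- `ApexPlaneExit`: `O = ∅`, `o ≥ 2`, NOT unary, and TWO INDEPENDENT invariance vectors (`2 ≤ e ≤ m - 1`; at `m = 3` exactly `e = 2`: the apex of
`in_o f` is a plane, `in_o f = F(ℓ₁, ℓ₂)` a binary form in two independent linear forms, not a power of one) ⇒ the mover forces «NC, or admissible with
smaller head».  At `m = 3`: CJS's second key situation one AMBIENT dimension up (two `y`-variables `ℓ₁, ℓ₂`, two `u`-variables; Hironaka's polyhedron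
`Δ(f; u; y) ⊂ ℝ²`), fundamental sequences of Thms 5.35/5.40 (points and the projective lines of near points), with [OURS] (β) the preamble for a
2-dimensional component of the top locus through the point (outside CJS's condition (2)).  XXL; in print modulo (β) and transcription.  At `m = 2` the
hypotheses are contradictory (`TOT2Near.htwo_of_three`), so the piece is vacuous there. -/
def ApexPlaneExit (k : Type) [Field k] (m : ℕ) : Prop :=
  ∀ (b : MvPowerSeries (Fin (m + 1)) k) (δ : Decoration k m), Admissible b δ → 2 ≤ δ.o → δ.O = ∅ → ¬ UnaryVertex δ →
    (∃ v₁ v₂ : Fin (m + 1) → k, (∀ x : Fin (m + 1) → k, CobordantChart.initEval (fun _ : Fin (m + 1) => 1) (x + v₁) δ.c (δ.f * ∏ l ∈ δ.O, X l) =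
      CobordantChart.initEval (fun _ : Fin (m + 1) => 1) x δ.c (δ.f * ∏ l ∈ δ.O, X l)) ∧ (∀ x : Fin (m + 1) → k, CobordantChart.initEval (fun _ : Fin (m + 1) => 1) (x + v₂) δ.c (δ.f * ∏ l ∈ δ.O, X l) =
      CobordantChart.initEval (fun _ : Fin (m + 1) => 1) x δ.c (δ.f * ∏ l ∈ δ.O, X l)) ∧ ∀ α β : k, α • v₁ + β • v₂ = 0 → α = 0 ∧ β = 0) →
    DWinsTo (St := MvPowerSeries (Fin (m + 1)) k × Decoration k m) Prod.fst
      (fun τ => GermIsNC τ.1 ∨ (Admissible τ.1 τ.2 ∧ τ.2.head < δ.head)) (b, δ)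

/-- **THE APEX SUB-CUT OF `FreeLow` COMPOSES, WITH `e = 0` AND `e = 1`-ISOLATED DISCHARGED BY NAME FROM THE TREE** (every `m`, every field with
infinitely many elements): trivial apex ⇒ `dWinsTo_headDrop_of_apexTrivial` (one point blow-up, no near answer); apex a line and the point isolated
(no legal `Φ` with `InAxisIdeal c (Φ^* f)`) ⇒ `TOT2E1.dWinsTo_headDrop_of_isolated` (Hironaka's `δ(f; x′; z)` descent, CJS Cor. 5.37); apex a line,
not isolated ⇒ `ApexLineCurveExit`; two independent invariance vectors ⇒ `ApexPlaneExit`. -/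
theorem freeLow_of_apexCut [Infinite k] (hcrv : ApexLineCurveExit k m) (hpl : ApexPlaneExit k m) : FreeLow k m := by
  intro b δ hadm ho hO hnU
  by_cases h0 : ∀ u : Fin (m + 1) → k, (∀ x : Fin (m + 1) → k, CobordantChart.initEval (fun _ : Fin (m + 1) => 1) (x + u) δ.c (δ.f * ∏ l ∈ δ.O, X l) =
      CobordantChart.initEval (fun _ : Fin (m + 1) => 1) x δ.c (δ.f * ∏ l ∈ δ.O, X l)) → u = 0
  · exact (dWinsTo_headDrop_of_apexTrivial hadm h0).mono fun τ hτ => Or.inr hτ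
  · push Not at h0
    obtain ⟨u, hu, hu0⟩ := h0
    by_cases hcol : ∀ v₁ v₂ : Fin (m + 1) → k, (∀ x : Fin (m + 1) → k, CobordantChart.initEval (fun _ : Fin (m + 1) => 1) (x + v₁) δ.c (δ.f * ∏ l ∈ δ.O, X l) =
      CobordantChart.initEval (fun _ : Fin (m + 1) => 1) x δ.c (δ.f * ∏ l ∈ δ.O, X l)) → (∀ x : Fin (m + 1) → k, CobordantChart.initEval (fun _ : Fin (m + 1) => 1) (x + v₂) δ.c (δ.f * ∏ l ∈ δ.O, X l) =
      CobordantChart.initEval (fun _ : Fin (m + 1) => 1) x δ.c (δ.f * ∏ l ∈ δ.O, X l)) → ∃ α β : k, (α ≠ 0 ∨ β ≠ 0) ∧ α • v₁ + β • v₂ = 0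
    · by_cases hisol : ∀ Φ : Fin (m + 1) → MvPowerSeries (Fin (m + 1)) k, (∀ l, constantCoeff (Φ l) = 0) →
          IsUnit (Matrix.det (Matrix.of fun a j : Fin (m + 1) => coeff (Finsupp.single j 1) (Φ a))) →
          ¬ AxisPolyhedron.InAxisIdeal δ.c (subst Φ (δ.f * ∏ l ∈ δ.O, X l))
      · exact (TOT2E1.dWinsTo_headDrop_of_isolated hadm ho ⟨u, hu0, hu⟩ hcol hisol).mono fun τ hτ => Or.inr hτ
      · push Not at hisol
        obtain ⟨Φ, hΦ0, hΦdet, hax⟩ := hisol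
        exact hcrv b δ hadm ho hO ⟨u, hu0, hu⟩ hcol ⟨Φ, hΦ0, hΦdet, hax⟩
    · push Not at hcol
      obtain ⟨v₁, v₂, h₁, h₂, hind⟩ := hcol
      refine hpl b δ hadm ho hO hnU ⟨v₁, v₂, h₁, h₂, fun α β hαβ => ?_⟩
      by_contra hne
      exact hind α β (not_and_or.mp hne) hαβ

/-- `FreeLow` from the two residual apex pieces, then the whole cut: (RD_m) ⟸ `OldExit`, `ApexLineCurveExit`, `ApexPlaneExit`, `FreeTame p`,
`CoreUnaryWild p`, `EndOrd`. -/
theorem rd_of_histApexCut [Infinite k] {p : ℕ} (hold : OldExit k m) (hcrv : ApexLineCurveExit k m) (hpl : ApexPlaneExit k m)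
    (htame : FreeTame p k m) (hwild : CoreUnaryWild p k m) (hend : EndOrd k m) : RD k m :=
  rd_of_histCut hold (freeLow_of_apexCut hcrv hpl) htame hwild hend

/-! ### Stub E is the door one dimension LOWER (res-D-pv-006, p539872, every `m`) -/

/-- **`RD k m → EndOrd k (m + 1)`** — the ordinal endgame rung in `m + 2` variables from the rank-drop statement in `m + 1` variables
(`NCTransport.exists_winsOrd_orderOne_mul_prod_of_rankDrop`, res-D-pv-006 p539872: Weierstrass graph form + the graph lift `winsOrd_graphRel`
p539140 + R8's normal form, all with ordinal wins).  At `m = 2`: the line's stub E (`EndOrd k 3`) IS the registered door stub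
`stub_spaceNCRankDrop` (`RD k 2`). -/
theorem endOrd_of_rd (hRD : RD k m) : EndOrd k (m + 1) :=
  fun f hf E => NCTransport.exists_winsOrd_orderOne_mul_prod_of_rankDrop hRD f hf E

/-- (RD_{m+1}) ⟸ the five pieces in dimension `m + 1` and (RD_m): the INDUCTIVE form of the cut. -/
theorem rd_succ_of_histApexCut [Infinite k] {p : ℕ} (hold : OldExit k (m + 1)) (hcrv : ApexLineCurveExit k (m + 1))
    (hpl : ApexPlaneExit k (m + 1)) (htame : FreeTame p k (m + 1)) (hwild : CoreUnaryWild p k (m + 1)) (hRD : RD k m) : RD k (m + 1) :=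
  rd_of_histApexCut hold hcrv hpl htame hwild (endOrd_of_rd hRD)


end TameFourTupleDrop

end Summit.ResolutionOfSingularities.ResolutionOfSingularities.Theorems

end
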